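import Mathlib
import HarnessLib
import Summits.Ventures.LatticeQCDFlow.Scoring.UStatisticVarianceIntegral

/-!
# LatticeQCDFlow / Scoring — the two Hoeffding projections of an order-2 U-statistic on a GENERAL
# measurable space, `0 ≤ 2ζ₁ ≤ ζ₂`, and the sandwich `4ζ₁/n ≤ Var U ≤ 2ζ₂/n`

HONEST FRAMING: exact (Metropolis-corrected) sampling algorithms for lattice gauge theory;
figures of merit are autocorrelation/cost numbers at stated couplings and volumes; no
continuum-physics claim.

Venture `LatticeQCDFlow` (cell pub-lqcd), sub-topic `Scoring`; FANOUT row 3 (`s0-u1-a`, S0-B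
implementation A, GEN-10).  The MEASURE-THEORETIC form of row 3's `Scoring/UStatisticProjections`
(GEN-8: finite sums) — our formalisation of a PUBLISHED fact, Hoeffding (1948, Ann. Math. Statist.
19, 293–325, §5: `ζ₁ ≤ ζ₂/2` and `m²ζ₁/n ≤ Var U ≤ mζ_m/n`, here `m = 2`), NAMED ONLY as the printed
counterpart; NO definition is introduced.  Companion of row 3's `Scoring/UStatisticVarianceIntegral`
(imported: the exact law `E[(U − μ_F)²] = (2(c₂ − μ_F²) + 4(n − 2)(c₁ − μ_F²))/(n(n − 1))` for
`n ≥ 2` independent draws with common law `ν` on any measurable space and a symmetric kernel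
`F ∈ L²(ν ⊗ ν)`) and of its toolkit `Scoring/IIDKernelMoments`.

## Setting (`ν` a probability measure on `X`; `F` symmetric, measurable, `F ∈ L²(ν ⊗ ν)`;
## `μ_F = ∫ F d(ν⊗ν)`, `h(a) = ∫ F(a, b) dν(b)`, `c₁ = ∫ h² dν`, `c₂ = ∫ F² d(ν⊗ν)`,
## `ζ₁ = c₁ − μ_F²`, `ζ₂ = c₂ − μ_F²`)

* `stronglyMeasurable_condMean`, **`memLp_condMean_two`** — Hoeffding's projection `h` is in
  `L²(ν)` (a.e.-Jensen in `b`, then Tonelli), with `integral_condMean_sq_le` (`c₁ ≤ c₂`) and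
  `integral_condMean_eq` (`∫ h dν = μ_F`, Fubini);
* **`sq_kernelMean_le_condMeanSq`** — `μ_F² ≤ c₁` (`ζ₁ = Var_ν h ≥ 0`);
* `integral_doubleDiff_sq` — `E[(A − B − C + D)²]` from the ten partner moments of four `L²`
  variables (bookkeeping);
* **`two_mul_condVar_le_kernelVar_integral`** — `2(c₁ − μ_F²) ≤ c₂ − μ_F²` (`2ζ₁ ≤ ζ₂`), by a
  FOUR-DRAW identity instead of the finite file's conditional Jensen: on the product space
  `(Fin 4 → X, ν^{⊗4})` the double difference
  `G = F(φ₀, φ₁) − F(φ₀, φ₂) − F(φ₃, φ₁) + F(φ₃, φ₂)` has `E[G²] = 4(c₂ − 2c₁ + μ_F²)` (four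
  coincident partners `c₂`, eight index-sharing partners `−c₁`, four disjoint partners `+μ_F²`, by
  `Scoring/IIDKernelMoments`), and `E[G²] ≥ 0`;
* **`variance_ustat₂_eq_leading_add_iid`** — `E[(U − μ_F)²] = 4ζ₁/n + 2(ζ₂ − 2ζ₁)/(n(n − 1))`;
  **`variance_ustat₂_le_iid`** — `E[(U − μ_F)²] ≤ 2ζ₂/n`; **`le_variance_ustat₂_iid`** —
  `4ζ₁/n ≤ E[(U − μ_F)²]`; `mul_variance_ustat₂_antitone` — `n ↦ n·Var U_n` is non-increasing
  (`k·Var U_k = 4ζ₁ + 2(ζ₂ − 2ζ₁)/(k − 1)`).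

NOT CLAIMED: higher-order kernels; asymptotic normality; nothing about any statistic of ours.
-/

namespace Summit.Ventures.LatticeQCDFlow.Scoring

open MeasureTheory ProbabilityTheory Finset

/-! ### Hoeffding's projection of a square-integrable kernel -/

section Projection

variable {X : Type*} [MeasurableSpace X] {ν : Measure X} [IsProbabilityMeasure ν] {F : X → X → ℝ}

omit [IsProbabilityMeasure ν] in
/-- Hoeffding's projection `a ↦ ∫ F(a, b) dν(b)` of a measurable kernel is strongly measurable.
[folklore] -/
theorem stronglyMeasurable_condMean [SFinite ν] (hFm : Measurable fun z : X × X => F z.1 z.2) :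
    StronglyMeasurable fun a => ∫ b, F a b ∂ν :=
  hFm.stronglyMeasurable.integral_prod_right'

/-- **`F ∈ L²(ν ⊗ ν)` ⇒ `h = ∫ F(·, b) dν(b) ∈ L²(ν)`** (for `ν`-a.e. `a`, `F(a, ·) ∈ L²(ν)` and
`h(a)² ≤ ∫ F(a, b)² dν(b)` by Jensen; the right side is `ν`-integrable by Tonelli). [folklore] -/
theorem memLp_condMean_two (hFm : Measurable fun z : X × X => F z.1 z.2)
    (hF2 : MemLp (fun z : X × X => F z.1 z.2) 2 (ν.prod ν)) :
    MemLp (fun a => ∫ b, F a b ∂ν) 2 ν := by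
  have hsm := stronglyMeasurable_condMean (ν := ν) hFm
  rw [memLp_two_iff_integrable_sq hsm.aestronglyMeasurable]
  have hI2 : Integrable (fun z : X × X => F z.1 z.2 ^ 2) (ν.prod ν) := hF2.integrable_sq
  refine Integrable.mono' hI2.integral_prod_left (hsm.measurable.pow_const 2).aestronglyMeasurable
    ?_
  filter_upwards [hI2.prod_right_ae] with a ha
  have hFa : MemLp (fun b => F a b) 2 ν :=
    (memLp_two_iff_integrable_sq
      (hFm.comp (measurable_prodMk_left (x := a))).aestronglyMeasurable).2 ha
  have hv := variance_nonneg (fun b => F a b) ν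
  rw [variance_eq_sub hFa] at hv
  simp only [Pi.pow_apply] at hv
  rw [Real.norm_of_nonneg (sq_nonneg _)]
  linarith

/-- **`c₁ ≤ c₂`**: `∫ h² dν ≤ ∫ F² d(ν ⊗ ν)` (the same a.e.-Jensen bound, integrated).
[folklore] -/
theorem integral_condMean_sq_le (hFm : Measurable fun z : X × X => F z.1 z.2)
    (hF2 : MemLp (fun z : X × X => F z.1 z.2) 2 (ν.prod ν)) :
    ∫ a, (∫ b, F a b ∂ν) ^ 2 ∂ν ≤ ∫ z, F z.1 z.2 ^ 2 ∂(ν.prod ν) := by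
  have hI2 : Integrable (fun z : X × X => F z.1 z.2 ^ 2) (ν.prod ν) := hF2.integrable_sq
  rw [integral_prod _ hI2]
  refine integral_mono_ae (memLp_condMean_two hFm hF2).integrable_sq hI2.integral_prod_left ?_
  filter_upwards [hI2.prod_right_ae] with a ha
  have hFa : MemLp (fun b => F a b) 2 ν :=
    (memLp_two_iff_integrable_sq
      (hFm.comp (measurable_prodMk_left (x := a))).aestronglyMeasurable).2 ha
  have hv := variance_nonneg (fun b => F a b) ν
  rw [variance_eq_sub hFa] at hv
  simp only [Pi.pow_apply] at hv
  linarith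

/-- **`∫ h dν = μ_F`** (Fubini): `∫ (∫ F(a, b) dν(b)) dν(a) = ∫ F d(ν ⊗ ν)`. [folklore] -/
theorem integral_condMean_eq (hF2 : MemLp (fun z : X × X => F z.1 z.2) 2 (ν.prod ν)) :
    ∫ a, ∫ b, F a b ∂ν ∂ν = ∫ z, F z.1 z.2 ∂(ν.prod ν) :=
  (integral_prod (fun z : X × X => F z.1 z.2) (hF2.integrable one_le_two)).symm

/-- **`ζ₁ ≥ 0`, i.e. `μ_F² ≤ c₁`**: `(∫ F d(ν ⊗ ν))² ≤ ∫ (∫ F(a, b) dν(b))² dν(a)` — the variance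
of Hoeffding's projection is non-negative. [folklore] -/
theorem sq_kernelMean_le_condMeanSq (hFm : Measurable fun z : X × X => F z.1 z.2)
    (hF2 : MemLp (fun z : X × X => F z.1 z.2) 2 (ν.prod ν)) :
    (∫ z, F z.1 z.2 ∂(ν.prod ν)) ^ 2 ≤ ∫ a, (∫ b, F a b ∂ν) ^ 2 ∂ν := by
  have hv := variance_nonneg (fun a => ∫ b, F a b ∂ν) ν
  rw [variance_eq_sub (memLp_condMean_two hFm hF2)] at hv
  simp only [Pi.pow_apply] at hv
  rw [integral_condMean_eq hF2] at hv
  linarith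

end Projection

/-! ### `2ζ₁ ≤ ζ₂` by a four-draw identity -/

section FourDraws

/-- Bookkeeping: the second moment of a double difference `A − B − C + D` of four `L²` variables
from its ten partner moments. [folklore] -/
theorem integral_doubleDiff_sq {Ω' : Type*} [MeasurableSpace Ω'] {Q : Measure Ω'}
    {A B C D : Ω' → ℝ} (hA : MemLp A 2 Q) (hB : MemLp B 2 Q) (hC : MemLp C 2 Q)
    (hD : MemLp D 2 Q) :
    ∫ ω, (A ω - B ω - C ω + D ω) ^ 2 ∂Q
      = ∫ ω, A ω * A ω ∂Q + ∫ ω, B ω * B ω ∂Q + ∫ ω, C ω * C ω ∂Q + ∫ ω, D ω * D ω ∂Q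
        - 2 * ∫ ω, A ω * B ω ∂Q - 2 * ∫ ω, A ω * C ω ∂Q + 2 * ∫ ω, A ω * D ω ∂Q
        + 2 * ∫ ω, B ω * C ω ∂Q - 2 * ∫ ω, B ω * D ω ∂Q - 2 * ∫ ω, C ω * D ω ∂Q := by
  have iAA : Integrable (fun ω => A ω * A ω) Q := hA.integrable_mul hA
  have iBB : Integrable (fun ω => B ω * B ω) Q := hB.integrable_mul hB
  have iCC : Integrable (fun ω => C ω * C ω) Q := hC.integrable_mul hC
  have iDD : Integrable (fun ω => D ω * D ω) Q := hD.integrable_mul hD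
  have iAB : Integrable (fun ω => 2 * (A ω * B ω)) Q := (hA.integrable_mul hB).const_mul 2
  have iAC : Integrable (fun ω => 2 * (A ω * C ω)) Q := (hA.integrable_mul hC).const_mul 2
  have iAD : Integrable (fun ω => 2 * (A ω * D ω)) Q := (hA.integrable_mul hD).const_mul 2
  have iBC : Integrable (fun ω => 2 * (B ω * C ω)) Q := (hB.integrable_mul hC).const_mul 2
  have iBD : Integrable (fun ω => 2 * (B ω * D ω)) Q := (hB.integrable_mul hD).const_mul 2
  have iCD : Integrable (fun ω => 2 * (C ω * D ω)) Q := (hC.integrable_mul hD).const_mul 2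
  have e : ∀ ω, (A ω - B ω - C ω + D ω) ^ 2
      = A ω * A ω + B ω * B ω + C ω * C ω + D ω * D ω - 2 * (A ω * B ω) - 2 * (A ω * C ω)
        + 2 * (A ω * D ω) + 2 * (B ω * C ω) - 2 * (B ω * D ω) - 2 * (C ω * D ω) := by
    intro ω; ring
  simp_rw [e]
  have h2 : Integrable (fun ω => A ω * A ω + B ω * B ω) Q := iAA.add iBB
  have h3 : Integrable (fun ω => A ω * A ω + B ω * B ω + C ω * C ω) Q := h2.add iCC
  have h4 : Integrable (fun ω => A ω * A ω + B ω * B ω + C ω * C ω + D ω * D ω) Q := h3.add iDD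
  have h5 : Integrable (fun ω => A ω * A ω + B ω * B ω + C ω * C ω + D ω * D ω
      - 2 * (A ω * B ω)) Q := h4.sub iAB
  have h6 : Integrable (fun ω => A ω * A ω + B ω * B ω + C ω * C ω + D ω * D ω
      - 2 * (A ω * B ω) - 2 * (A ω * C ω)) Q := h5.sub iAC
  have h7 : Integrable (fun ω => A ω * A ω + B ω * B ω + C ω * C ω + D ω * D ω
      - 2 * (A ω * B ω) - 2 * (A ω * C ω) + 2 * (A ω * D ω)) Q := h6.add iAD
  have h8 : Integrable (fun ω => A ω * A ω + B ω * B ω + C ω * C ω + D ω * D ω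
      - 2 * (A ω * B ω) - 2 * (A ω * C ω) + 2 * (A ω * D ω) + 2 * (B ω * C ω)) Q := h7.add iBC
  have h9 : Integrable (fun ω => A ω * A ω + B ω * B ω + C ω * C ω + D ω * D ω
      - 2 * (A ω * B ω) - 2 * (A ω * C ω) + 2 * (A ω * D ω) + 2 * (B ω * C ω)
      - 2 * (B ω * D ω)) Q := h8.sub iBD
  rw [integral_sub h9 iCD, integral_sub h8 iBD, integral_add h7 iBC, integral_add h6 iAD,
    integral_sub h5 iAC, integral_sub h4 iAB, integral_add h3 iDD, integral_add h2 iCC,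
    integral_add iAA iBB, integral_const_mul, integral_const_mul, integral_const_mul,
    integral_const_mul, integral_const_mul, integral_const_mul]

variable {X : Type*} [MeasurableSpace X] {ν : Measure X} [IsProbabilityMeasure ν] {F : X → X → ℝ}

/-- **`2ζ₁ ≤ ζ₂`, i.e. `2(c₁ − μ_F²) ≤ c₂ − μ_F²`** for a symmetric kernel `F ∈ L²(ν ⊗ ν)` on any
measurable space: on `(Fin 4 → X, ν^{⊗4})` the double difference
`G = F(φ₀, φ₁) − F(φ₀, φ₂) − F(φ₃, φ₁) + F(φ₃, φ₂)` has `0 ≤ E[G²] = 4(c₂ − 2c₁ + μ_F²)`.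
[folklore] -/
theorem two_mul_condVar_le_kernelVar_integral (hFm : Measurable fun z : X × X => F z.1 z.2)
    (hF : ∀ a b, F a b = F b a) (hF2 : MemLp (fun z : X × X => F z.1 z.2) 2 (ν.prod ν)) :
    2 * ((∫ a, (∫ b, F a b ∂ν) ^ 2 ∂ν) - (∫ z, F z.1 z.2 ∂(ν.prod ν)) ^ 2)
      ≤ (∫ z, F z.1 z.2 ^ 2 ∂(ν.prod ν)) - (∫ z, F z.1 z.2 ∂(ν.prod ν)) ^ 2 := by
  -- four i.i.d. draws with law `ν`, realised as the coordinates of the product space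
  set P4 : Measure (Fin 4 → X) := Measure.pi fun _ : Fin 4 => ν with hP4
  have hym : ∀ i : Fin 4, Measurable fun φ : Fin 4 → X => φ i := fun i => measurable_pi_apply i
  have hind : iIndepFun (fun (i : Fin 4) (φ : Fin 4 → X) => φ i) P4 :=
    iIndepFun_pi (X := fun _ : Fin 4 => @id X) fun _ => aemeasurable_id
  have hlaw : ∀ i : Fin 4, Measure.map (fun φ : Fin 4 → X => φ i) P4 = ν := fun i =>
    (measurePreserving_eval (fun _ : Fin 4 => ν) i).map_eq
  have h01 : (0 : Fin 4) ≠ 1 := by decide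
  have h02 : (0 : Fin 4) ≠ 2 := by decide
  have h03 : (0 : Fin 4) ≠ 3 := by decide
  have h12 : (1 : Fin 4) ≠ 2 := by decide
  have h13 : (1 : Fin 4) ≠ 3 := by decide
  have h23 : (2 : Fin 4) ≠ 3 := by decide
  -- the four kernel terms are in `L²(P4)`
  have hA : MemLp (fun φ : Fin 4 → X => F (φ 0) (φ 1)) 2 P4 :=
    memLp_kernel_iid hym hind hlaw hF2 h01
  have hB : MemLp (fun φ : Fin 4 → X => F (φ 0) (φ 2)) 2 P4 :=
    memLp_kernel_iid hym hind hlaw hF2 h02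
  have hC : MemLp (fun φ : Fin 4 → X => F (φ 3) (φ 1)) 2 P4 :=
    memLp_kernel_iid hym hind hlaw hF2 h13.symm
  have hD : MemLp (fun φ : Fin 4 → X => F (φ 3) (φ 2)) 2 P4 :=
    memLp_kernel_iid hym hind hlaw hF2 h23.symm
  -- the ten partner moments
  have hAA : ∫ φ, F (φ 0) (φ 1) * F (φ 0) (φ 1) ∂P4 = ∫ z, F z.1 z.2 ^ 2 ∂(ν.prod ν) :=
    integral_kernel_mul_self_iid hym hind hlaw hFm h01
  have hBB : ∫ φ, F (φ 0) (φ 2) * F (φ 0) (φ 2) ∂P4 = ∫ z, F z.1 z.2 ^ 2 ∂(ν.prod ν) :=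
    integral_kernel_mul_self_iid hym hind hlaw hFm h02
  have hCC : ∫ φ, F (φ 3) (φ 1) * F (φ 3) (φ 1) ∂P4 = ∫ z, F z.1 z.2 ^ 2 ∂(ν.prod ν) :=
    integral_kernel_mul_self_iid hym hind hlaw hFm h13.symm
  have hDD : ∫ φ, F (φ 3) (φ 2) * F (φ 3) (φ 2) ∂P4 = ∫ z, F z.1 z.2 ^ 2 ∂(ν.prod ν) :=
    integral_kernel_mul_self_iid hym hind hlaw hFm h23.symm
  have hAB : ∫ φ, F (φ 0) (φ 1) * F (φ 0) (φ 2) ∂P4 = ∫ a, (∫ b, F a b ∂ν) ^ 2 ∂ν :=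
    integral_kernel_mul_kernel_shared_iid hym hind hlaw hFm hF2 h01 h02 h12
  have hAC : ∫ φ, F (φ 0) (φ 1) * F (φ 3) (φ 1) ∂P4 = ∫ a, (∫ b, F a b ∂ν) ^ 2 ∂ν :=
    integral_kernel_mul_kernel_of_shared_iid hym hind hlaw hFm hF hF2 h01 h13.symm
      (Or.inr (Or.inr (Or.inr rfl))) (fun h => h03 h.1.symm) (fun h => h01 h.2.symm)
  have hAD : ∫ φ, F (φ 0) (φ 1) * F (φ 3) (φ 2) ∂P4 = (∫ z, F z.1 z.2 ∂(ν.prod ν)) ^ 2 :=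
    integral_kernel_mul_kernel_disjoint_iid hym hind hlaw hFm hF2 h01 h23.symm h03 h02 h13 h12
  have hBC : ∫ φ, F (φ 0) (φ 2) * F (φ 3) (φ 1) ∂P4 = (∫ z, F z.1 z.2 ∂(ν.prod ν)) ^ 2 :=
    integral_kernel_mul_kernel_disjoint_iid hym hind hlaw hFm hF2 h02 h13.symm h03 h01 h23
      h12.symm
  have hBD : ∫ φ, F (φ 0) (φ 2) * F (φ 3) (φ 2) ∂P4 = ∫ a, (∫ b, F a b ∂ν) ^ 2 ∂ν :=
    integral_kernel_mul_kernel_of_shared_iid hym hind hlaw hFm hF hF2 h02 h23.symm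
      (Or.inr (Or.inr (Or.inr rfl))) (fun h => h03 h.1.symm) (fun h => h02 h.2.symm)
  have hCD : ∫ φ, F (φ 3) (φ 1) * F (φ 3) (φ 2) ∂P4 = ∫ a, (∫ b, F a b ∂ν) ^ 2 ∂ν :=
    integral_kernel_mul_kernel_shared_iid hym hind hlaw hFm hF2 h13.symm h23.symm h12
  -- `0 ≤ E[G²] = 4(c₂ − 2c₁ + μ_F²)`
  have hG := integral_doubleDiff_sq hA hB hC hD
  rw [hAA, hBB, hCC, hDD, hAB, hAC, hAD, hBC, hBD, hCD] at hG
  have hnn : 0 ≤ ∫ φ, (F (φ 0) (φ 1) - F (φ 0) (φ 2) - F (φ 3) (φ 1) + F (φ 3) (φ 2)) ^ 2 ∂P4 :=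
    integral_nonneg fun φ => sq_nonneg _
  rw [hG] at hnn
  linarith

end FourDraws

/-! ### Consequences for the U-statistic: leading term and sandwich -/

section Sandwich

variable {Ω : Type*} [MeasurableSpace Ω] {P : Measure Ω} [IsProbabilityMeasure P]
variable {X : Type*} [MeasurableSpace X] {ν : Measure X}
variable {n : ℕ} {x : Fin n → Ω → X}

/-- **Hoeffding's law rearranged**: `E[(U − μ_F)²] = 4ζ₁/n + 2(ζ₂ − 2ζ₁)/(n(n − 1))` — the
i.i.d.-like leading term plus a NON-NEGATIVE correction (`two_mul_condVar_le_kernelVar_integral`).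
[folklore] -/
theorem variance_ustat₂_eq_leading_add_iid (hxm : ∀ i, Measurable (x i)) (hind : iIndepFun x P)
    (hlaw : ∀ i, Measure.map (x i) P = ν) {F : X → X → ℝ}
    (hFm : Measurable fun z : X × X => F z.1 z.2) (hF : ∀ a b, F a b = F b a)
    (hF2 : MemLp (fun z : X × X => F z.1 z.2) 2 (ν.prod ν)) (hn : 2 ≤ n) :
    ∫ ω, ((∑ z ∈ (univ : Finset (Fin n)).offDiag, F (x z.1 ω) (x z.2 ω)) / (n * (n - 1))
        - ∫ z, F z.1 z.2 ∂(ν.prod ν)) ^ 2 ∂P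
      = 4 * ((∫ a, (∫ b, F a b ∂ν) ^ 2 ∂ν) - (∫ z, F z.1 z.2 ∂(ν.prod ν)) ^ 2) / n
        + 2 * (((∫ z, F z.1 z.2 ^ 2 ∂(ν.prod ν)) - (∫ z, F z.1 z.2 ∂(ν.prod ν)) ^ 2)
            - 2 * ((∫ a, (∫ b, F a b ∂ν) ^ 2 ∂ν) - (∫ z, F z.1 z.2 ∂(ν.prod ν)) ^ 2))
          / (n * (n - 1)) := by
  rw [variance_ustat₂_eq_iid hxm hind hlaw hFm hF hF2 hn]
  have h2 : (2 : ℝ) ≤ n := by exact_mod_cast hn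
  have hn0 : (n : ℝ) ≠ 0 := by positivity
  have hn1 : (n : ℝ) - 1 ≠ 0 := (by linarith : (0 : ℝ) < n - 1).ne'
  field_simp
  ring

/-- **Hoeffding's sandwich, upper half**: `E[(U − μ_F)²] ≤ 2ζ₂/n = 2(c₂ − μ_F²)/n`. [folklore] -/
theorem variance_ustat₂_le_iid (hxm : ∀ i, Measurable (x i)) (hind : iIndepFun x P)
    (hlaw : ∀ i, Measure.map (x i) P = ν) {F : X → X → ℝ}
    (hFm : Measurable fun z : X × X => F z.1 z.2) (hF : ∀ a b, F a b = F b a)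
    (hF2 : MemLp (fun z : X × X => F z.1 z.2) 2 (ν.prod ν)) (hn : 2 ≤ n) :
    ∫ ω, ((∑ z ∈ (univ : Finset (Fin n)).offDiag, F (x z.1 ω) (x z.2 ω)) / (n * (n - 1))
        - ∫ z, F z.1 z.2 ∂(ν.prod ν)) ^ 2 ∂P
      ≤ 2 * ((∫ z, F z.1 z.2 ^ 2 ∂(ν.prod ν)) - (∫ z, F z.1 z.2 ∂(ν.prod ν)) ^ 2) / n := by
  haveI := isProbabilityMeasure_of_map_eq_iid (hxm ⟨0, by omega⟩) (hlaw ⟨0, by omega⟩)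
  rw [variance_ustat₂_eq_iid hxm hind hlaw hFm hF hF2 hn]
  have hproj := two_mul_condVar_le_kernelVar_integral (ν := ν) hFm hF hF2
  have h2 : (2 : ℝ) ≤ n := by exact_mod_cast hn
  have hnpos : (0 : ℝ) < n := by linarith
  have hn1 : (0 : ℝ) < n - 1 := by linarith
  rw [div_le_div_iff₀ (mul_pos hnpos hn1) hnpos]
  have h4 : (0 : ℝ) ≤ 2 * (n - 2) := by linarith
  nlinarith [mul_le_mul_of_nonneg_left hproj h4, mul_pos hnpos hn1]

/-- **Hoeffding's sandwich, lower half**: `4ζ₁/n = 4(c₁ − μ_F²)/n ≤ E[(U − μ_F)²]`. [folklore] -/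
theorem le_variance_ustat₂_iid (hxm : ∀ i, Measurable (x i)) (hind : iIndepFun x P)
    (hlaw : ∀ i, Measure.map (x i) P = ν) {F : X → X → ℝ}
    (hFm : Measurable fun z : X × X => F z.1 z.2) (hF : ∀ a b, F a b = F b a)
    (hF2 : MemLp (fun z : X × X => F z.1 z.2) 2 (ν.prod ν)) (hn : 2 ≤ n) :
    4 * ((∫ a, (∫ b, F a b ∂ν) ^ 2 ∂ν) - (∫ z, F z.1 z.2 ∂(ν.prod ν)) ^ 2) / n
      ≤ ∫ ω, ((∑ z ∈ (univ : Finset (Fin n)).offDiag, F (x z.1 ω) (x z.2 ω)) / (n * (n - 1))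
        - ∫ z, F z.1 z.2 ∂(ν.prod ν)) ^ 2 ∂P := by
  haveI := isProbabilityMeasure_of_map_eq_iid (hxm ⟨0, by omega⟩) (hlaw ⟨0, by omega⟩)
  rw [variance_ustat₂_eq_iid hxm hind hlaw hFm hF hF2 hn]
  have hproj := two_mul_condVar_le_kernelVar_integral (ν := ν) hFm hF hF2
  have h2 : (2 : ℝ) ≤ n := by exact_mod_cast hn
  have hnpos : (0 : ℝ) < n := by linarith
  have hn1 : (0 : ℝ) < n - 1 := by linarith
  rw [div_le_div_iff₀ hnpos (mul_pos hnpos hn1)]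
  nlinarith [mul_pos hnpos hn1]

/-- **`n ↦ n·Var U_n` is non-increasing** (Hoeffding 1948, §5): for `2 ≤ m ≤ n`,
`n·(2ζ₂ + 4(n − 2)ζ₁)/(n(n − 1)) ≤ m·(2ζ₂ + 4(m − 2)ζ₁)/(m(m − 1))`, because
`k·Var U_k = 4ζ₁ + 2(ζ₂ − 2ζ₁)/(k − 1)` and `ζ₂ − 2ζ₁ ≥ 0`
(`two_mul_condVar_le_kernelVar_integral`).  Stated for the explicit law of
`variance_ustat₂_eq_iid`. [folklore] -/
theorem mul_variance_ustat₂_antitone [IsProbabilityMeasure ν] {F : X → X → ℝ}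
    (hFm : Measurable fun z : X × X => F z.1 z.2) (hF : ∀ a b, F a b = F b a)
    (hF2 : MemLp (fun z : X × X => F z.1 z.2) 2 (ν.prod ν)) {m k : ℕ} (hm : 2 ≤ m)
    (hmk : m ≤ k) :
    (k : ℝ) * ((2 * ((∫ z, F z.1 z.2 ^ 2 ∂(ν.prod ν)) - (∫ z, F z.1 z.2 ∂(ν.prod ν)) ^ 2)
          + 4 * (k - 2) * ((∫ a, (∫ b, F a b ∂ν) ^ 2 ∂ν) - (∫ z, F z.1 z.2 ∂(ν.prod ν)) ^ 2))
        / (k * (k - 1)))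
      ≤ (m : ℝ) * ((2 * ((∫ z, F z.1 z.2 ^ 2 ∂(ν.prod ν)) - (∫ z, F z.1 z.2 ∂(ν.prod ν)) ^ 2)
          + 4 * (m - 2) * ((∫ a, (∫ b, F a b ∂ν) ^ 2 ∂ν) - (∫ z, F z.1 z.2 ∂(ν.prod ν)) ^ 2))
        / (m * (m - 1))) := by
  have hproj := two_mul_condVar_le_kernelVar_integral (ν := ν) hFm hF hF2
  set A := (∫ z, F z.1 z.2 ^ 2 ∂(ν.prod ν)) - (∫ z, F z.1 z.2 ∂(ν.prod ν)) ^ 2 with hA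
  set B := (∫ a, (∫ b, F a b ∂ν) ^ 2 ∂ν) - (∫ z, F z.1 z.2 ∂(ν.prod ν)) ^ 2 with hB
  have hm2 : (2 : ℝ) ≤ m := by exact_mod_cast hm
  have hmk' : (m : ℝ) ≤ k := by exact_mod_cast hmk
  have key : ∀ j : ℕ, (2 : ℝ) ≤ j →
      (j : ℝ) * ((2 * A + 4 * (j - 2) * B) / (j * (j - 1)))
        = 4 * B + 2 * (A - 2 * B) / (j - 1) := by
    intro j hj
    have hj0 : (j : ℝ) ≠ 0 := by positivity
    have hj1 : (j : ℝ) - 1 ≠ 0 := (by linarith : (0 : ℝ) < j - 1).ne'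
    field_simp
    ring
  rw [key k (hm2.trans hmk'), key m hm2]
  have hnum : 0 ≤ 2 * (A - 2 * B) := by linarith
  have := div_le_div_of_nonneg_left hnum (by linarith : (0 : ℝ) < m - 1)
    (by linarith : (m : ℝ) - 1 ≤ k - 1)
  linarith

end Sandwich

end Summit.Ventures.LatticeQCDFlow.Scoring
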